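import Summits.ResolutionOfSingularities.ResolutionOfSingularities.Theorems.StallVertexDrift
import HarnessLib

/-!
# StallVertexDrift2 — decomp-res lens-5 g30 «StallVertexDrift», tree file 2/2

Continuation 2/2 of `StallVertexDrift` (same landing file 61237ca2, cut after `end AlgebraDrift` at the 400-line
cap): carries `section WalkDrift`
(§2g THE DRIFT LAW at walk level — `TangentDatum`, T3 `drift_law` with `CleanMove ⟺ c'_j = 0`, the first tail layer
and RESONANCE `p ∣ w ∨ c'_j = 0`;
one `set_option maxHeartbeats 1600000 in` kept verbatim from the lens) and `section LeafDrift` (§3e T4 `drift_io`: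
on the tangent leaf the osculating
plane drifts infinitely often).  Provenance, critic row 195 and the lens header in full in part 1
`StallVertexDrift`.  VERBATIM; namespace
`…Theorems.StallVertex`; `--kind proof --supports stmt-ResolutionOfSingularities-31770`. -/

noncomputable section

open MvPolynomial Finset
open Literature.AlgebraicGeometry.Resolution
open Literature.AlgebraicGeometry.Resolution.Hauser2010
open Literature.AlgebraicGeometry.Resolution.HauserPerlega2024
open Literature.Barriers.ResolutionOfSingularities
open Literature.AlgebraicGeometry.Resolution.PointBlowup
open Summit.ResolutionOfSingularities.ResolutionOfSingularities.Theses
open Summit.ResolutionOfSingularities.ResolutionOfSingularities.Theorems.TightDefectClasses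
open Summit.ResolutionOfSingularities.ResolutionOfSingularities.Theorems.ProximityCut
open Summit.ResolutionOfSingularities.ResolutionOfSingularities.Theorems.ExitLaw
open Summit.ResolutionOfSingularities.ResolutionOfSingularities.Theorems.DifferentialShade

namespace Summit.ResolutionOfSingularities.ResolutionOfSingularities.Theorems.StallVertex

section WalkDrift

variable {K : Type} [Field K] [DecidableEq K]

/-! ### §2g (rev 11, generation 30) THE DRIFT LAW ON THE TANGENT LEAF: clean ⟺ carried; the interfering layer is the drift -/

/-- A TANGENT DATUM `(r, c, w)` of the minimiser `J₀` at time `t` — the body of `TangentAt`: `in(g_{J₀}(t)) = r · u^{B(t)}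
· (Σ c_i u_i)^w`, `r ≠ 0`, `w ≥ 1`, the plane through the direction of move `t`. [new object] -/
def TangentDatum {q : ℕ} {s₀ : State (Fin 3) K} (W : ForcedWalk q s₀) (t : ℕ) (J₀ : Fin 3 →₀ ℕ)
    (r : K) (c : Fin 3 → K) (w : ℕ) : Prop :=
  r ≠ 0 ∧ 0 < w ∧
    ordZero ((ifp W t).gen J₀) = (((youngExp W t J₀).degree + w : ℕ) : ℕ∞) ∧
    homogeneousComponent ((youngExp W t J₀).degree + w) ((ifp W t).gen J₀) =
      monomial (youngExp W t J₀) r * (∑ i, C (c i) * X i) ^ w ∧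
    ∑ i, c i * Function.update (W.b t) (W.j t) 1 i = 0

/-- `TangentAt` = some tangent datum. [folklore] -/
theorem tangentAt_iff {q : ℕ} {s₀ : State (Fin 3) K} (W : ForcedWalk q s₀) (t : ℕ) (J₀ : Fin 3 →₀ ℕ) :
    TangentAt W t J₀ ↔ ∃ (r : K) (c : Fin 3 → K) (w : ℕ), TangentDatum W t J₀ r c w := Iff.rfl

set_option maxHeartbeats 1600000 in
/-- **T3 — THE DRIFT LAW.**  On a positive skew stalled tail (flat law in force), at a move `t ≥ N` with persisting
minimiser `J₀` (generator `G = g_{J₀}(t)` of order `d₀`, level `a`, chart letter `j = j_t`, vertex order `n = m + 1 ≥ 1`)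
and ANY tangent datum `(r', c', w)` at `t + 1`:
(D1) the interfering layer of the tail is the binomial difference quotient of the plane's DRIFT `γ_t = c'_j`:
`u_j · in_m(tailForm) = r' u^{B(t+1)∖j} · (H'^w − (H'♭)^w)`;
(D2) the move is CLEAN iff the plane is CARRIED (`c'_j = 0`) — INTERFERENCE = DRIFT, for every `p`, `w`;
(D1♭) `in_m(tailForm) = w γ_t · r' u^{B(t+1)∖j} (H'♭)^{w−1} + u_j · R`;
(D2♭) that first layer vanishes iff `p ∣ w` (RESONANCE) or the plane is carried.
(Kawanoue–Matsuki's translation `x̃' = x̃ + c^{1/p^{e₂}} x̃_j` of the second LGS element, arXiv:1205.4556 Proposition 4 (1),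
read at cone level on the forced walk; new as a walk law.) [new] [folklore] -/
theorem drift_law {p e : ℕ} (hp : p.Prime) [CharP K p] {s₀ : State (Fin 3) K}
    (hs : IsRoot (p ^ e) s₀) (W : ForcedWalk (p ^ e) s₀) (N : ℕ)
    (hstall : ∀ t, N ≤ t → (ifp W (t + 1)).muTilde (p ^ e) = (ifp W t).muTilde (p ^ e))
    (hskew : ∀ (k : Fin 3) (N' : ℕ), ∃ t, N' ≤ t ∧ (W.j t = k ∨ W.b t k ≠ 0))
    (hpos : (0 : WithTop ℚ) < (ifp W N).muTilde (p ^ e)) {t : ℕ} (ht : N ≤ t)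
    {J₀ : Fin 3 →₀ ℕ} (hJ₀ : J₀ ∈ (ifp W t).idx)
    (hμ : (ifp W t).muP (p ^ e) = levelRatio (ordZero ((ifp W t).gen J₀)) (p ^ e - J₀.degree))
    {d₀ : ℕ} (hd₀ : ordZero ((ifp W t).gen J₀) = d₀)
    {r' : K} {c' : Fin 3 → K} {w : ℕ} (h' : TangentDatum W (t + 1) J₀ r' c' w) :
    ∃ m : ℕ,
      ordZero (dirForm d₀ (W.j t) (W.b t) ((ifp W t).gen J₀)) = ((m + 1 : ℕ) : ℕ∞) ∧
      X (W.j t) * homogeneousComponent m (tailForm d₀ (W.j t) (W.b t) ((ifp W t).gen J₀)) =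
        monomial (Finsupp.erase (W.j t) (youngExp W (t + 1) J₀)) r' *
          ((∑ i, C (c' i) * X i) ^ w - (∑ i, C (Function.update c' (W.j t) 0 i) * X i) ^ w) ∧
      (CleanMove d₀ (W.j t) (W.b t) ((ifp W t).gen J₀) ↔ c' (W.j t) = 0) ∧
      (∃ R : MvPolynomial (Fin 3) K,
        homogeneousComponent m (tailForm d₀ (W.j t) (W.b t) ((ifp W t).gen J₀)) =
          (w : MvPolynomial (Fin 3) K) * C (c' (W.j t)) *
              monomial (Finsupp.erase (W.j t) (youngExp W (t + 1) J₀)) r' *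
              (∑ i, C (Function.update c' (W.j t) 0 i) * X i) ^ (w - 1) + X (W.j t) * R) ∧
      ((w : MvPolynomial (Fin 3) K) * C (c' (W.j t)) *
            monomial (Finsupp.erase (W.j t) (youngExp W (t + 1) J₀)) r' *
            (∑ i, C (Function.update c' (W.j t) 0 i) * X i) ^ (w - 1) = 0 ↔
          p ∣ w ∨ c' (W.j t) = 0) := by
  classical
  obtain ⟨hr', hw, hord', hcomp', -⟩ := h'
  have hst := hstall t ht
  have hg₀ne := gen_ne_zero_of_minimiser hp hs W t hμ
  have hledger := stall_ledger (p ^ e) (W.j t) (W.b t) (W.onExc t) (ifp W t) (fun J hJ => (level_bounds W t J hJ).2)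
    (sing_ifp hp hs W t) (by rw [← ifp_succ]; exact hst.symm.le) hJ₀ hμ hd₀
  have hrig := stall_rigid (p ^ e) (W.j t) (W.b t) (W.onExc t) (ifp W t) (fun J hJ => (level_bounds W t J hJ).2)
    (sing_ifp hp hs W t) (by rw [← ifp_succ]; exact hst.symm.le) hJ₀ hμ hd₀
  obtain ⟨hJ₀', hμ'⟩ := minimiser_succ hp hs W t hst hJ₀ hμ
  have hflat := flat_law hp hs W N hstall hskew
  have ha0 : 0 < p ^ e - J₀.degree := by have := (level_bounds W t J₀ hJ₀).2; omega
  -- abbreviations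
  set a := p ^ e - J₀.degree with ha
  set j := W.j t with hj
  set b := W.b t with hb
  have hbj : b j = 0 := W.onExc t
  set G := (ifp W t).gen J₀ with hG
  set n := (ordZero (dirForm d₀ j b G)).toNat with hn
  have hTn : ordZero (dirForm d₀ j b G) = n := (coe_toNat_ordZero (dirForm_ne_zero j b hd₀)).symm
  have had₀ : a ≤ d₀ := by
    have := sing_ifp hp hs W t J₀ hJ₀ hg₀ne; rw [hd₀] at this; exact_mod_cast this
  have hgen : (ifp W (t + 1)).gen J₀ = PointBlowup.translate b (chartTransform a j G) := by rw [ifp_succ]; rfl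
  have hord2 : ordZero ((ifp W (t + 1)).gen J₀) = ((d₀ - a + n : ℕ) : ℕ∞) := by rw [ifp_succ]; exact hrig.2.1
  have hg'ne : (ifp W (t + 1)).gen J₀ ≠ 0 := gen_ne_zero_of_minimiser hp hs W (t + 1) hμ'
  -- the young letters at `t + 1` are `j` and the kept young letters of `t`
  have hyoung' : (ifp W (t + 1)).young = insert j ((ifp W t).young.filter fun i => b i = 0) := by rw [ifp_succ]; rfl
  have hjy' : j ∈ (ifp W (t + 1)).young := by rw [hyoung']; exact Finset.mem_insert_self _ _
  have hkept' : ∀ i ∈ (ifp W (t + 1)).young, i ≠ j → i ∈ (ifp W t).young ∧ b i = 0 := by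
    intro i hi hij
    rw [hyoung', Finset.mem_insert] at hi
    rcases hi with h | h
    · exact absurd h hij
    · exact Finset.mem_filter.mp h
  -- `n ≥ 1`
  have hpos_t : (0 : WithTop ℚ) < (ifp W t).muTilde (p ^ e) := by rw [muTilde_eq_of_stall W hstall ht]; exact hpos
  have hn0 : n ≠ 0 := by
    intro h0
    apply ordZero_dirForm_ne_zero_of_stall_pos (p ^ e) j b hbj (ifp W t) (fun J hJ => (level_bounds W t J hJ).2)
      (sing_ifp hp hs W t) (by rw [← ifp_succ]; exact hst.symm.le) hpos_t hJ₀ hμ hd₀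
    rw [hTn, h0, Nat.cast_zero]
  obtain ⟨m₁, hm₁⟩ : ∃ m₁, m₁ + 1 = n := ⟨n - 1, by omega⟩
  -- the two-layer form of `in(g_{t+1})`
  set A := homogeneousComponent n (dirForm d₀ j b G) with hA
  set B := homogeneousComponent m₁ (tailForm d₀ j b G) with hB
  have hAne : A ≠ 0 := homogeneousComponent_ne_zero_of_ordZero_eq hTn
  have hAfree : ∀ e' ∈ A.support, e' j = 0 :=
    fun e' he' => dirForm_free d₀ b hbj G e' (mem_support_of_mem_support_homogeneousComponent he')
  have hlayer : homogeneousComponent (d₀ - a + n) ((ifp W (t + 1)).gen J₀) = X j ^ (d₀ - a) * (A + X j * B) := by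
    rw [hgen, move_eq_layer b hbj had₀ hd₀, homogeneousComponent_X_pow_mul, map_add]
    congr 2
    have h1 := homogeneousComponent_X_pow_mul j 1 m₁ (tailForm d₀ j b G)
    rw [pow_one, add_comm, hm₁] at h1
    exact h1
  -- the new exceptional letter: `ord_{u_j} g_{t+1} = d₀ - a`
  have hεj : (divisorOrder j ((ifp W (t + 1)).gen J₀)).toNat = d₀ - a := by
    apply le_antisymm
    · obtain ⟨e₁, he₁⟩ := MvPolynomial.ne_zero_iff.mp hAne
      have hmem : e₁ + Finsupp.single j (d₀ - a) ∈ ((ifp W (t + 1)).gen J₀).support := by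
        apply mem_support_of_mem_support_homogeneousComponent (d := d₀ - a + n)
        rw [MvPolynomial.mem_support_iff, hlayer,
          coeff_two_layer_low j (d₀ - a) A B (hAfree e₁ (MvPolynomial.mem_support_iff.mpr he₁))]
        exact he₁
      have h := divisorOrder_le_exponent (i := j) hmem
      rw [← ENat.coe_toNat (divisorOrder_ne_top (i := j) hg'ne), Nat.cast_le, Finsupp.add_apply,
        hAfree e₁ (MvPolynomial.mem_support_iff.mpr he₁), Finsupp.single_eq_same, zero_add] at h
      exact h
    · have h := le_divisorOrder_new b hbj a G
      rw [← hgen, hd₀, ENat.toNat_coe, ← ENat.coe_toNat (divisorOrder_ne_top (i := j) hg'ne), Nat.cast_le] at h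
      exact h
  -- the kept young letters keep their divisor orders (flat law at `t` and `t+1`, `stall_ledger` (6))
  have hεkept : ∀ i ∈ (ifp W (t + 1)).young, i ≠ j →
      (divisorOrder i ((ifp W (t + 1)).gen J₀)).toNat = (divisorOrder i G).toNat := by
    intro i hi hij
    obtain ⟨hiy, hbi⟩ := hkept' i hi hij
    have h6 := hledger.1 i hiy hij hbi
    rw [← ifp_succ] at h6
    have hf' := hflat (t + 1) (by omega) J₀ hJ₀' hμ' i hi
    have hf := hflat t ht J₀ hJ₀ hμ i hiy
    unfold NondefAt at hf hf'
    rw [h6, hf, ← ENat.coe_toNat (divisorOrder_ne_top (i := i) hg₀ne),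
      ← ENat.coe_toNat (divisorOrder_ne_top (i := i) hg'ne)] at hf'
    exact (levelRatio_natCast_inj ha0 hf').symm
  -- the young exponent at `t + 1` splits off the chart letter
  set S'' : Fin 3 →₀ ℕ := ∑ i ∈ ((ifp W (t + 1)).young).erase j,
    Finsupp.single i (divisorOrder i ((ifp W (t + 1)).gen J₀)).toNat with hS''
  have hS''_apply : ∀ i, S'' i = if i ∈ ((ifp W (t + 1)).young).erase j then
      (divisorOrder i ((ifp W (t + 1)).gen J₀)).toNat else 0 := by
    intro i
    rw [hS'', Finsupp.coe_finsetSum, Finset.sum_apply]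
    simp_rw [Finsupp.single_apply]
    exact Finset.sum_ite_eq' _ i _
  have hS''j : S'' j = 0 := by rw [hS''_apply, if_neg (Finset.notMem_erase j _)]
  have hY' : youngExp W (t + 1) J₀ = S'' + Finsupp.single j (d₀ - a) := by
    unfold youngExp
    rw [← Finset.add_sum_erase _ _ hjy', hεj, add_comm]
  have herase : Finsupp.erase j (youngExp W (t + 1) J₀) = S'' := by
    ext i
    by_cases hij : i = j
    · rw [hij, Finsupp.erase_same, hS''j]
    · rw [Finsupp.erase_ne hij, hY', Finsupp.add_apply, Finsupp.single_eq_of_ne hij, add_zero]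
  have hkey : X j ^ (d₀ - a) * (A + X j * B) =
      monomial (S'' + Finsupp.single j (d₀ - a)) r' * (∑ i, C (c' i) * X i) ^ w := by
    have hdeg' : (youngExp W (t + 1) J₀).degree + w = d₀ - a + n := by
      have := hord'.symm.trans hord2; exact_mod_cast this
    rw [← hlayer, ← hY', ← hdeg', hcomp']
  -- the carried plane is non-zero (A2)
  have hA2 := low_layer_of_cone j (d₀ - a) B hAfree S'' hS''j r' c' w hkey
  have hl : ∃ i, Function.update c' j 0 i ≠ 0 := by
    by_contra hnone
    push Not at hnone
    apply hAne
    rw [hA2, show (∑ i, C (Function.update c' j 0 i) * X i : MvPolynomial (Fin 3) K) = 0 from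
      Finset.sum_eq_zero fun i _ => by rw [hnone i, C_0, zero_mul], zero_pow hw.ne', mul_zero]
  -- D2: clean ⟺ `B = 0` ⟺ carried
  have hB0 : CleanMove d₀ j b G ↔ B = 0 := by
    constructor
    · intro hc
      show homogeneousComponent m₁ (tailForm d₀ j b G) = 0
      apply homogeneousComponent_eq_zero_of_lt_ordZero
      by_contra hle
      push Not at hle
      have h1 : 1 + ordZero (tailForm d₀ j b G) ≤ (n : ℕ∞) := by
        calc 1 + ordZero (tailForm d₀ j b G) ≤ 1 + (m₁ : ℕ∞) := add_le_add le_rfl hle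
          _ = (n : ℕ∞) := by rw [← hm₁, Nat.cast_add, Nat.cast_one, add_comm]
      unfold CleanMove at hc
      rw [hTn] at hc
      exact absurd (lt_of_lt_of_le hc h1) (lt_irrefl _)
    · intro hB0
      by_contra hunc
      obtain ⟨m, hmn, -, hBne, -⟩ := resonance b hbj had₀ hd₀ hTn (by rw [← hgen]; exact hord2) hunc
      have hmm : m = m₁ := by omega
      rw [hmm] at hBne
      exact hBne hB0
  have hD2 := high_layer_eq_zero_iff j (d₀ - a) B hAfree S'' hS''j hr' c' hw hkey
  have hD1 := drift_layer j (d₀ - a) B hAfree S'' hS''j r' c' w hkey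
  obtain ⟨m, rfl⟩ : ∃ m, w = m + 1 := ⟨w - 1, by omega⟩
  obtain ⟨R, hR⟩ := first_drift_layer j (d₀ - a) B hAfree S'' hS''j r' c' m hkey
  refine ⟨m₁, by rw [hTn, hm₁], ?_, hB0.trans hD2, ⟨R, ?_⟩, ?_⟩
  · rw [herase]; exact hD1
  · rw [herase, Nat.add_sub_cancel]; exact hR
  · rw [herase, Nat.add_sub_cancel, first_drift_layer_eq_zero_iff j S'' hr' c' hl (m + 1) m,
      CharP.cast_eq_zero_iff K p]

end WalkDrift

section LeafDrift

/-! ### §3e (rev 11, generation 30) ON THE TANGENT LEAF THE OSCULATING PLANE TRANSLATES INFINITELY OFTEN -/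

/-- **T4 — DRIFT INFINITELY OFTEN (the located residual read through the drift law).**  On the binders of the tangent
leaf `NoTangentPositiveSkewStalledTailsDeep` (a line-free rigid positive skew stalled tail): for every `M` there is a
move `t ≥ M, N` and a `μ_P`-minimiser `J₀ ∈ idx(t)` such that the companion's cone at `t + 1` is a pure power of a
plane (`tangent_law`) and EVERY tangent datum at `t + 1` DRIFTS — `c'_{j_t} ≠ 0`: the osculating plane at the new point
is NOT the carried plane (`unclean_io_of_muTilde_pos` + D2).  Kawanoue–Matsuki's «Moreover `c ≠ 0`» (arXiv:1205.4556,
Proposition 4 (1)) as a theorem about the forced walk: on every tail of the located residual the hypersurface of maximal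
contact is translated infinitely often; in particular «eventually carried ⟹ `ContactLineFrom`» never fires. [new] [folklore] -/
theorem drift_io (p : ℕ) (hp : p.Prime) (e : ℕ) (he : 2 ≤ e) (K : Type) [Field K] [CharP K p]
    [PerfectField K] [DecidableEq K] (s₀ : State (Fin 3) K) (hs : IsRoot (p ^ e) s₀) (W : ForcedWalk (p ^ e) s₀)
    (hsh : ∀ i, 1 ≤ (W.st i).shade) (N : ℕ) (hplat : ∀ t, N ≤ t → (W.st (t + 1)).shade = (W.st t).shade)
    (hexc : ∀ t, N ≤ t → ordZero (W.st t).F ≠ ((p ^ e : ℕ) : ℕ∞))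
    (hS : ∀ M : ℕ, ∃ t, M ≤ t ∧ StaysOnNewest W t) (hT : ∀ M : ℕ, ∃ t, M ≤ t ∧ W.b t ≠ 0)
    (hskew : ∀ (k : Fin 3) (N' : ℕ), ∃ t, N' ≤ t ∧ (W.j t = k ∨ W.b t k ≠ 0))
    (hstall : ∀ t, N ≤ t → (ifp W (t + 1)).muTilde (p ^ e) = (ifp W t).muTilde (p ^ e))
    (hrig : ∀ t, N ≤ t → VertexLawEqAt W t) (horig : ∀ t, N ≤ t → OriginLawAt W t)
    (hlf : ∀ (s : ℕ) (c : Fin 3 → K), ¬ ContactLineFrom W s c)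
    (hpos : (0 : WithTop ℚ) < (ifp W N).muTilde (p ^ e)) :
    ∀ M : ℕ, ∃ t, M ≤ t ∧ N ≤ t ∧ ∃ J₀ ∈ (ifp W t).idx,
      (ifp W t).muP (p ^ e) = levelRatio (ordZero ((ifp W t).gen J₀)) (p ^ e - J₀.degree) ∧
      TangentAt W (t + 1) J₀ ∧
      ∀ (r' : K) (c' : Fin 3 → K) (w : ℕ), TangentDatum W (t + 1) J₀ r' c' w → c' (W.j t) ≠ 0 := by
  intro M
  obtain ⟨t, ht, hunc⟩ := unclean_io_of_muTilde_pos p hp e he K s₀ hs W hsh N hplat hexc hS hT hskew hstall hrig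
    horig hlf hpos (max M N) (le_max_right M N)
  have hMt : M ≤ t := le_trans (le_max_left M N) ht
  have hNt : N ≤ t := le_trans (le_max_right M N) ht
  unfold CleanAt at hunc
  push Not at hunc
  obtain ⟨J₀, hJ₀, hμ, d₀, hd₀, hnc⟩ := hunc
  obtain ⟨hJ₀', hμ'⟩ := minimiser_succ hp hs W t (hstall t hNt) hJ₀ hμ
  refine ⟨t, hMt, hNt, J₀, hJ₀, hμ, tangent_law hp hs W N hstall hskew hS hpos (t + 1) (by omega) J₀ hJ₀' hμ', ?_⟩
  intro r' c' w h' hc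
  obtain ⟨m, -, -, hclean, -⟩ := drift_law hp hs W N hstall hskew hpos hNt hJ₀ hμ hd₀ h'
  exact hnc (hclean.mpr hc)

end LeafDrift


end Summit.ResolutionOfSingularities.ResolutionOfSingularities.Theorems.StallVertex
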